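import Summits.SmoothPoincare4.SmoothPoincare4.Theses.WeylBudget
import Summits.SmoothPoincare4.SmoothPoincare4.Theorems.WeylBudgetBudgetTransferMeasure
import Summits.SmoothPoincare4.SmoothPoincare4.Theorems.WeylBudgetBudgetTransferPointwise
import Summits.SmoothPoincare4.SmoothPoincare4.Theorems.WeylBudgetCorkRegluingBudgetIsometricRegluingTransport
import Literature.Geometry.Riemannian.ChangGurskyYangProofs
import HarnessLib

/-!
# Stub B1b of the crux `CorkRegluingBudget`: diffeomorphism invariance and the linearisable case

Crux `Summit.SmoothPoincare4.SmoothPoincare4.Theses.WeylBudget.CorkRegluingBudget` (item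
stmt-SmoothPoincare4-10831, route WeylBudget), line `registered` (`Lines/birth.lean`, RESHAPE 2),
open stub B1b `stub_weylLightPscWithSymmetricGerm` (held by the lead): given a τ-symmetric germ
`(g₁, U, Φ)` along the seam of a cork splitting of `S⁴`, find a Riemannian `g` on `S⁴` with
Levi-Civita connection, `scal_g > 0`, `g.weylEnergy < 32π²` and an open `U' ⊆ U` containing the
seam on which `Φ` is a `g`-isometry.  Everything here is proved; no definitions, no named facts.

* `weylEnergy_eq_of_diffeomorph_pullbackBilin_eq` — **the Weyl energy is an isometry invariant**
  (reusable brick): if `F : X ≅ P` is a diffeomorphism of 4-manifolds with `F^* g = γ` for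
  Riemannian `g`, `γ`, then `γ.weylEnergy = g.weylEnergy` (pointwise naturality of `|W|²`,
  `weylNormSq_eq_of_pullbackBilin_eq`, plus the change of variables along an isometric
  diffeomorphism, `setLIntegral_range_of_localIsometry`: isometries preserve the Riemannian measure).
* `weylLightPscWithSymmetricGerm_of_conjugateRound` — **B1b in the linearisable case**: if the
  germ `Φ` is smoothly conjugate near the seam to a round isometry — `θ ∘ Φ = R ∘ θ` on an open
  `U₀ ⊇ seam`, `U₀ ⊆ U`, for a diffeomorphism `θ` of `S⁴` and a smooth map `R` preserving the round
  metric — then the conclusion of B1b holds with `g := θ^* g_round` (`scal_g = 12 ∘ θ > 0`,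
  `∫|W_g|² = ∫|W_round|² = 0 < 32π²`) and `U' := U₀`.  This extends the landed round-equivariant
  case (`symmetricWeylLightMetric_of_roundEquivariant`, p149906: `θ = id`) to its orbit under
  `Diff(S⁴)`, i.e. to every germ smoothly equivalent to a linear one (e.g. `Y` an unknotted round
  `S³ ⊂ S⁴` with `τ` conjugate to an orthogonal involution).  What remains open of B1b is exactly
  the non-linearisable germs (cork boundaries `Y = Σ(2,5,7)`, …; see the lead analyses
  `Lines/birth-lead-c1-analysis.md`, `Lines/registered-lead-c2-analysis.md`).

References: B. O'Neill, *Semi-Riemannian Geometry* (1983), Ch. 3, Prop. 3.59 [ONeill1983];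
J. M. Lee, *Introduction to Riemannian Manifolds* (2018), Prop. 2.51, Prop. 8.36 [Lee2018];
S.-Y. A. Chang, M. Gursky, P. Yang, Publ. IHÉS 98 (2003), Thm. A [ChangGurskyYang2003].
-/

-- the prescribed namespace `Summit.<P>.<Sub>.…` duplicates `SmoothPoincare4` (P = Sub)
set_option linter.dupNamespace false

open scoped Manifold ContDiff Topology ENNReal
-- Mathlib's scoped instance `Fact (finrank ℝ (EuclideanSpace ℝ (Fin n)) = n)`
open scoped EuclideanSpace
open Set Function MeasureTheory

noncomputable section

namespace Summit.SmoothPoincare4.SmoothPoincare4.Theorems.CorkRegluingBudget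

open Literature.Geometry.Lorentzian Literature.Geometry.Lorentzian.PseudoRiemannianMetric
  Literature.Geometry.Riemannian Literature.Topology.FourManifolds
open Summit.SmoothPoincare4.SmoothPoincare4.Theorems.BudgetTransfer

section Invariance

variable {X : Type*} [TopologicalSpace X] [T2Space X] [SecondCountableTopology X]
  [ChartedSpace (EuclideanSpace ℝ (Fin 4)) X] [IsManifold (𝓡 4) ∞ X]
  {P : Type*} [TopologicalSpace P] [T2Space P] [SecondCountableTopology P]
  [ChartedSpace (EuclideanSpace ℝ (Fin 4)) P] [IsManifold (𝓡 4) ∞ P]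

omit [T2Space X] [SecondCountableTopology X] [IsManifold (𝓡 4) ∞ X] [T2Space P]
  [SecondCountableTopology P] [IsManifold (𝓡 4) ∞ P] in
/-- The differential of a diffeomorphism is injective (`dF⁻¹ ∘ dF = id`). [folklore] -/
theorem injective_mfderiv_diffeomorph (F : X ≃ₘ⟮𝓡 4, 𝓡 4⟯ P) (x : X) :
    Injective (mfderiv (𝓡 4) (𝓡 4) F x) := fun v w h ↦ by
  have h' := congrArg (mfderiv (𝓡 4) (𝓡 4) F.symm (F x)) h
  rwa [mfderiv_symm_apply_mfderiv F x v, mfderiv_symm_apply_mfderiv F x w] at h'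

/-- **The Weyl energy is invariant under isometric diffeomorphisms.**  If `F : X ≅ P` is a
diffeomorphism of Hausdorff second-countable smooth 4-manifolds and `g`, `γ` are Riemannian
metrics (with their Levi-Civita connections) on `P`, `X` with `F^* g = γ`, then
`∫_X |W_γ|² dV_γ = ∫_P |W_g|² dV_g`: the Weyl norm is natural under local isometries
(`|W_γ|²(x) = |W_g|²(F x)`, O'Neill 1983, Prop. 3.59) and an isometric diffeomorphism carries the
Riemannian measure of `X` to that of `P` (Lee 2018, Prop. 2.51; change of variables
`∫_{F(X)} f dV_g = ∫_X f ∘ F dV_γ` with `F(X) = P`). [cite: ONeill1983, Ch. 3, Prop. 3.59]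
[cite: Lee2018, Prop. 2.51] -/
theorem weylEnergy_eq_of_diffeomorph_pullbackBilin_eq
    (g : PseudoRiemannianMetric (𝓡 4) ∞ (EuclideanSpace ℝ (Fin 4)) (TangentSpace (𝓡 4) : P → Type _))
    [g.HasLeviCivita]
    (γ : PseudoRiemannianMetric (𝓡 4) ∞ (EuclideanSpace ℝ (Fin 4)) (TangentSpace (𝓡 4) : X → Type _))
    [γ.HasLeviCivita] (hg : g.IsRiemannian) (hγ : γ.IsRiemannian) (F : X ≃ₘ⟮𝓡 4, 𝓡 4⟯ P)
    (hiso : ∀ x, pullbackBilin (I := 𝓡 4) (I' := 𝓡 4) F g.val x = γ.val x) :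
    γ.weylEnergy = g.weylEnergy := by
  haveI : LocallyCompactSpace X := Manifold.locallyCompact_of_finiteDimensional (𝓡 4)
  haveI : LocallyCompactSpace P := Manifold.locallyCompact_of_finiteDimensional (𝓡 4)
  letI : MeasurableSpace X := borel X
  haveI : BorelSpace X := ⟨rfl⟩
  letI : MeasurableSpace P := borel P
  haveI : BorelSpace P := ⟨rfl⟩
  have hFs : ContMDiff (𝓡 4) (𝓡 4) ∞ F := F.contMDiff
  have hF' : ∀ x, Injective (mfderiv (𝓡 4) (𝓡 4) F x) := injective_mfderiv_diffeomorph F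
  -- pointwise naturality of `|W|²`
  have hpt : ∀ x, γ.weylNormSq x = g.weylNormSq (F x) := fun x ↦ by
    have hid' : ∀ y : X, Injective (mfderiv (𝓡 4) (𝓡 4) (id : X → X) y) := fun y ↦ by
      rw [mfderiv_id]
      exact injective_id
    have h := weylNormSq_eq_of_pullbackBilin_eq g γ hg hγ hFs hF' contMDiff_id hid'
      (fun y ↦ by rw [pullbackBilin_id]; exact hiso y) x
    simpa using h
  -- `F` is an isometry `(X, γ) → (P, g)`
  have hisoF : ∀ (x : X) (v w : TangentSpace (𝓡 4) x),
      g.val (F x) (mfderiv (𝓡 4) (𝓡 4) F x v) (mfderiv (𝓡 4) (𝓡 4) F x w) = γ.val x v w := by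
    intro x v w
    rw [← pullbackBilin_apply, hiso x]
  rw [γ.weylEnergy_eq hγ, g.weylEnergy_eq hg]
  have hcv := setLIntegral_range_of_localIsometry hγ hg hFs F.injective F.isLocalDiffeomorph
    hisoF rfl (fun y ↦ ENNReal.ofReal (g.weylNormSq y))
  have hr : range (F : X → P) = univ := range_eq_univ.2 F.surjective
  rw [hr, Measure.restrict_univ] at hcv
  rw [hcv]
  exact lintegral_congr fun x ↦ by rw [hpt x]

end Invariance

/-- **Stub B1b in the linearisable case.**  Let `jC : C → S⁴` present the cork piece with boundary
data `bC` (only the seam `jC (ι ∂C)` is used), `U` an open set and `Φ : S⁴ → S⁴` smooth on `U`.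
Suppose the germ of `Φ` along the seam is SMOOTHLY CONJUGATE TO A ROUND ISOMETRY: there are a
diffeomorphism `θ` of `S⁴`, a smooth map `R : S⁴ → S⁴` preserving the round metric
(`R^* g_round = g_round`), and an open `U₀` with `seam ⊆ U₀ ⊆ U` on which `θ ∘ Φ = R ∘ θ`.  Then
the conclusion of B1b holds: with `g := θ^* g_round` (Riemannian, Levi-Civita connection
`hasLeviCivita`, `scal_g(x) = scal_round(θ x) = 12 > 0` by naturality `scalarCurvature_comap` and
`scalarCurvature_roundMetric_pos`, `∫|W_g|² = ∫|W_round|² = 0 < 32π²` by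
`weylEnergy_eq_of_diffeomorph_pullbackBilin_eq` and `weylEnergy_roundMetric_eq_zero`) and
`U' := U₀`, the map `Φ` is a `g`-isometry on `U₀`: `Φ^* θ^* g_r = (θΦ)^* g_r = (Rθ)^* g_r = θ^* R^* g_r = θ^* g_r`
near each point of `U₀` (chain rule and locality of the differential).  The case `θ = id` is the
landed round-equivariant case (p149906). [cite: ONeill1983, Ch. 3, Prop. 3.59]
[cite: Lee2018, Prop. 8.36] [cite: ChangGurskyYang2003, Thm. A (round model)] -/
theorem weylLightPscWithSymmetricGerm_of_conjugateRound :
    ∀ (C : Type) [TopologicalSpace C] [ChartedSpace (EuclideanHalfSpace 4) C]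
      (bC : Literature.Topology.FourManifolds.BoundaryData (𝓡∂ 4) C (𝓡 3))
      (jC : C → Metric.sphere (0 : EuclideanSpace ℝ (Fin 5)) 1)
      (U : Set (Metric.sphere (0 : EuclideanSpace ℝ (Fin 5)) 1))
      (Φ : Metric.sphere (0 : EuclideanSpace ℝ (Fin 5)) 1 →
        Metric.sphere (0 : EuclideanSpace ℝ (Fin 5)) 1)
      (θ : Metric.sphere (0 : EuclideanSpace ℝ (Fin 5)) 1 ≃ₘ⟮𝓡 4, 𝓡 4⟯
        Metric.sphere (0 : EuclideanSpace ℝ (Fin 5)) 1)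
      (R : Metric.sphere (0 : EuclideanSpace ℝ (Fin 5)) 1 →
        Metric.sphere (0 : EuclideanSpace ℝ (Fin 5)) 1)
      (U₀ : Set (Metric.sphere (0 : EuclideanSpace ℝ (Fin 5)) 1)),
      ContMDiffOn (𝓡 4) (𝓡 4) ∞ Φ U →
      ContMDiff (𝓡 4) (𝓡 4) ∞ R →
      (∀ x, Literature.Geometry.Lorentzian.pullbackBilin (I := 𝓡 4) (I' := 𝓡 4) R
          (Literature.Geometry.Riemannian.roundMetric (n := 4) (EuclideanSpace ℝ (Fin 5))).val x =
        (Literature.Geometry.Riemannian.roundMetric (n := 4) (EuclideanSpace ℝ (Fin 5))).val x) →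
      IsOpen U₀ → U₀ ⊆ U → (∀ z, jC (bC.incl z) ∈ U₀) → (∀ x ∈ U₀, θ (Φ x) = R (θ x)) →
      ∃ (g : Literature.Geometry.Lorentzian.PseudoRiemannianMetric (𝓡 4) ∞ (EuclideanSpace ℝ (Fin 4))
          (TangentSpace (𝓡 4) : Metric.sphere (0 : EuclideanSpace ℝ (Fin 5)) 1 → Type _))
      (U' : Set (Metric.sphere (0 : EuclideanSpace ℝ (Fin 5)) 1)),
      g.IsRiemannian ∧
      (∃ _ : g.HasLeviCivita, (∀ x, 0 < g.scalarCurvature x) ∧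
          g.weylEnergy < ENNReal.ofReal (32 * Real.pi ^ 2)) ∧
      IsOpen U' ∧ U' ⊆ U ∧ (∀ z, jC (bC.incl z) ∈ U') ∧
      (∀ x ∈ U', Literature.Geometry.Lorentzian.pullbackBilin (I := 𝓡 4) (I' := 𝓡 4) Φ g.val x =
        g.val x) := by
  intro C _ _ bC jC U Φ θ R U₀ hΦs hR hRiso hU₀ hU₀U hYU₀ hconj
  set gr := roundMetric (n := 4) (EuclideanSpace ℝ (Fin 5))
  haveI : gr.HasLeviCivita := gr.hasLeviCivita
  have hgr : gr.IsRiemannian := isRiemannian_roundMetric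
  -- the transported round metric `g := θ^* g_round`
  have hθ : ContMDiff (𝓡 4) (𝓡 4) (((⊤ : ℕ∞) : ℕ∞ω) + 1) θ := θ.contMDiff
  have hθ' : ∀ x, Injective (mfderiv (𝓡 4) (𝓡 4) θ x) := injective_mfderiv_diffeomorph θ
  set g : PseudoRiemannianMetric (𝓡 4) ∞ (EuclideanSpace ℝ (Fin 4))
      (TangentSpace (𝓡 4) : Metric.sphere (0 : EuclideanSpace ℝ (Fin 5)) 1 → Type _) :=
    gr.comap (contMDiff_pullbackBilin_holds (I := 𝓡 4) (M := Metric.sphere (0 : EuclideanSpace ℝ (Fin 5)) 1)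
      (I' := 𝓡 4) (N := Metric.sphere (0 : EuclideanSpace ℝ (Fin 5)) 1)) θ hθ hθ' rfl with hg_def
  haveI : g.HasLeviCivita := g.hasLeviCivita
  have hgval : ∀ y, g.val y = pullbackBilin (I := 𝓡 4) (I' := 𝓡 4) θ gr.val y := fun y ↦ by
    rw [hg_def, val_comap]
  -- `g` is Riemannian (the differential of `θ` is injective)
  have hg : g.IsRiemannian := by
    intro p u hu
    rw [hgval, pullbackBilin_apply]
    exact hgr _ _ fun h ↦ hu (hθ' p (by rw [h, map_zero]))
  refine ⟨g, U₀, hg, ⟨‹_›, fun x ↦ ?_, ?_⟩, hU₀, hU₀U, hYU₀, fun x hx ↦ ?_⟩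
  · -- positive scalar curvature, by naturality
    have hsc : g.scalarCurvature x = gr.scalarCurvature (θ x) :=
      gr.scalarCurvature_comap _ hθ hθ' rfl x
    rw [hsc]
    exact scalarCurvature_roundMetric_pos (EuclideanSpace ℝ (Fin 5)) (by norm_num) (θ x)
  · -- the Weyl energy is that of the round metric, `0 < 32π²`
    have h0 : gr.weylEnergy = 0 :=
      weylEnergy_roundMetric_eq_zero (EuclideanSpace ℝ (Fin 5)) (by norm_num)
    rw [weylEnergy_eq_of_diffeomorph_pullbackBilin_eq gr g hgr hg θ (fun y ↦ (hgval y).symm), h0]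
    exact ENNReal.ofReal_pos.2 (by positivity)
  · -- `Φ` is a `g`-isometry on `U₀`: `Φ^* θ^* g_r = (θ ∘ Φ)^* g_r = (R ∘ θ)^* g_r = θ^* g_r`
    have hΦx : MDifferentiableAt (𝓡 4) (𝓡 4) Φ x :=
      (((hΦs.mono hU₀U) x hx).contMDiffAt (hU₀.mem_nhds hx)).mdifferentiableAt (by simp)
    have hθd : MDifferentiable (𝓡 4) (𝓡 4) θ := θ.contMDiff.mdifferentiable (by simp)
    have hRd : MDifferentiable (𝓡 4) (𝓡 4) R := hR.mdifferentiable (by simp)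
    have h1 : mfderiv (𝓡 4) (𝓡 4) (θ ∘ Φ) x =
        (mfderiv (𝓡 4) (𝓡 4) θ (Φ x)).comp (mfderiv (𝓡 4) (𝓡 4) Φ x) :=
      mfderiv_comp x (hθd _) hΦx
    have h2 : mfderiv (𝓡 4) (𝓡 4) (R ∘ θ) x =
        (mfderiv (𝓡 4) (𝓡 4) R (θ x)).comp (mfderiv (𝓡 4) (𝓡 4) θ x) :=
      mfderiv_comp x (hRd _) (hθd x)
    have h3 : (θ ∘ Φ : _ → Metric.sphere (0 : EuclideanSpace ℝ (Fin 5)) 1) =ᶠ[𝓝 x] (R ∘ θ) :=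
      Filter.eventuallyEq_of_mem (hU₀.mem_nhds hx) fun y hy ↦ hconj y hy
    have hkey : ∀ u : TangentSpace (𝓡 4) x,
        mfderiv (𝓡 4) (𝓡 4) θ (Φ x) (mfderiv (𝓡 4) (𝓡 4) Φ x u) =
          mfderiv (𝓡 4) (𝓡 4) R (θ x) (mfderiv (𝓡 4) (𝓡 4) θ x u) := fun u ↦ by
      have h := h1.symm.trans (h3.mfderiv_eq.trans h2)
      exact DFunLike.congr_fun h u
    have hpt : θ (Φ x) = R (θ x) := hconj x hx
    ext v w
    rw [pullbackBilin_apply, hgval, pullbackBilin_apply, hkey v, hkey w, hpt, ← pullbackBilin_apply,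
      hRiso (θ x), hgval, pullbackBilin_apply]

end Summit.SmoothPoincare4.SmoothPoincare4.Theorems.CorkRegluingBudget

end
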